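import Literature.NumberTheory.Automorphic.ZariskiGLProducts
import Literature.NumberTheory.Automorphic.ZariskiGLDimension
import Literature.RingTheory.KrullDimension.FibreDimension
import HarnessLib

/-!
# Dimension of fibres and orbits on `k`-points (Springer 5.1.6 (ii), 5.3.2 (ii))
(trunk T-AUTOMORPHIC, G25 AutomorphicL)

The dimension theory of morphisms needed by the structure theory of linear algebraic groups
(Springer, *Linear Algebraic Groups*, 2nd ed., 6.4.4–6.4.5, 7.1.5, 7.2.2), in the concrete
`k`-points vocabulary of `ZariskiAffineSpace.lean` / `ZariskiGL.lean` (affine space `σ → k` with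
the Zariski topology `zariskiTopologyPi`, subgroups of `GL n k` embedded by the coordinates
`glCoordFun = (x i j, det⁻¹)`), where the dimension of a subset `Z` is read as the Krull
dimension `dim k[x] ⧸ I(Z)` of its coordinate ring (for a connected algebraic subgroup this is
`IsZConnected.zdim`, `ZariskiGLDimension.lean`). The commutative algebra is
`Literature.RingTheory.KrullDimension.exists_ringKrullDim_quotient_eq_of_mem_minimalPrimes`
(`FibreDimension.lean`: generic fibres of `Spec B → Spec A` for affine domains `A ⊆ B`).
Proved here (over an algebraically closed field for the two main results):

* `exists_isOpen_ringKrullDim_fibre_eq` — **Springer 5.1.6 (ii) on `k`-points**: for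
  `V ⊆ kⁿ` closed irreducible and `φ : kⁿ → kᵐ` polynomial with `W = φ(V)⁻`, there are `r` with
  `dim V = dim W + r` and a Zariski open `U ⊆ kᵐ` meeting `φ(V)` such that for `y ∈ U` every
  irreducible component (maximal irreducible subset) of the fibre `V ∩ φ⁻¹ y` has dimension
  `r`. Dictionary: `k[W] = k[y]/I(W) ↪ k[V] = k[x]/I(V)` along the comorphism `bind₁ P`; the
  components of the fibre over `y` are the zero loci of the minimal primes over `𝔪_y k[V]`
  (Nullstellensatz);
* `ringKrullDim_quotient_vanishingIdeal_smul_eq` — left translation in `GL n k` does not change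
  `dim k[x, y] ⧸ I(X)` (`p ↦ p ∘ L_h` induces an isomorphism of coordinate rings);
* `exists_zdim_eq_zdim_identityComponent_add` — **dimension of orbits** (Springer 5.3.2 (ii) /
  2.3.3 in the form `dim G = dim G_v + dim (G·v)⁻`): for a connected algebraic `G ≤ GL n k`, a
  polynomial map `Φ` on `G` and its stabiliser `S` (`Φ g' = Φ g ↔ g⁻¹ g' ∈ S` on `G`),
  `dim G = dim S° + dim (Φ G)⁻`. Proof: the fibres of `Φ` over points of `Φ(G)` are the
  translates `g S`, whose irreducible components are translates of `S°`.

Also: vanishing ideals of irreducible sets are prime and conversely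
(`isPrime_vanishingIdeal_of_isIrreducible_pi`, `isIrreducible_of_isPrime_vanishingIdeal`,
Springer 1.2.5), closed sets are the zero loci of their vanishing ideals, maximal irreducible
subsets of closed sets are closed.

Not included (next steps of the programme): the lower bound `dim Z ≥ dim V - dim W` for the
components of *every* non-empty fibre and the upper semicontinuity of the fibre dimension
(Springer 5.2.7; they need the dimension formula `ht 𝔭 + dim A/𝔭 = dim A` for affine domains).

## References

* T. A. Springer, *Linear Algebraic Groups*, 2nd ed., Progress in Mathematics 9, Birkhäuser
  (1998), 1.2.5, 1.9.5, 2.1.2, 2.2.1, 2.3.3, 5.1.6, 5.3.2 [SpringerLAG1998].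
-/

noncomputable section

open MvPolynomial

namespace Literature.NumberTheory.Automorphic

variable {k : Type*} [Field k] {σ τ : Type*}

attribute [local instance] zariskiTopologyPi

/-! ### Vanishing ideals and zero loci of closed and of irreducible subsets of `kⁿ` -/

section Ideals

/-- A closed subset of `kⁿ` is the zero locus of its vanishing ideal. [folklore] -/
theorem zeroLocus_vanishingIdeal_of_isClosed {Z : Set (σ → k)} (hZ : IsClosed Z) :
    zeroLocus k (vanishingIdeal k Z) = Z := by
  obtain ⟨I, rfl⟩ := isClosed_iff_exists_zeroLocus.1 hZ
  refine Set.Subset.antisymm ?_ (zeroLocus_vanishingIdeal_le _)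
  exact zeroLocus_anti_mono (le_vanishingIdeal_zeroLocus I)

/-- The zero locus of the maximal ideal `𝔪_y` is `{y}`. [folklore] -/
theorem zeroLocus_vanishingIdeal_singleton (y : σ → k) :
    zeroLocus k (vanishingIdeal k ({y} : Set (σ → k))) = {y} :=
  zeroLocus_vanishingIdeal_of_isClosed (isClosed_singleton_pi y)

/-- The vanishing ideal of an irreducible subset of `kⁿ` is prime (Springer 1.2.5). [folklore] -/
theorem isPrime_vanishingIdeal_of_isIrreducible_pi {Z : Set (σ → k)} (hZ : IsIrreducible Z) :
    (vanishingIdeal k Z).IsPrime := by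
  refine ⟨fun h => ?_, fun {p q} hpq => ?_⟩
  · obtain ⟨z, hz⟩ := hZ.nonempty
    have h1 : (1 : MvPolynomial σ k) ∈ vanishingIdeal k Z := by rw [h]; trivial
    have := (mem_vanishingIdeal_iff.1 h1) z hz
    simp at this
  · have hsub : Z ⊆ {x | aeval x p = 0} ∪ {x | aeval x q = 0} := fun x hx => by
      have := (mem_vanishingIdeal_iff.1 hpq) x hx
      rw [map_mul, mul_eq_zero] at this
      exact this
    have hc : ∀ s : MvPolynomial σ k, IsClosed {x : σ → k | aeval x s = 0} := fun s =>
      isClosed_setOf_eval_eq_zero s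
    rcases (isPreirreducible_iff_isClosed_union_isClosed.1 hZ.isPreirreducible) _ _ (hc p) (hc q)
      hsub with h | h
    · exact Or.inl (mem_vanishingIdeal_iff.2 fun x hx => h hx)
    · exact Or.inr (mem_vanishingIdeal_iff.2 fun x hx => h hx)

/-- Conversely a non-empty subset of `kⁿ` with prime vanishing ideal is irreducible
(Springer 1.2.5). [folklore] -/
theorem isIrreducible_of_isPrime_vanishingIdeal {Z : Set (σ → k)}
    (hne : Z.Nonempty) (hp : (vanishingIdeal k Z).IsPrime) : IsIrreducible Z := by
  refine ⟨hne, isPreirreducible_iff_isClosed_union_isClosed.2 fun Z₁ Z₂ hZ₁ hZ₂ hsub => ?_⟩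
  by_contra h
  push Not at h
  obtain ⟨h1, h2⟩ := h
  -- points of `Z` outside `Z₁`, `Z₂` give polynomials outside the vanishing ideals
  have key : ∀ {Y : Set (σ → k)}, IsClosed Y → ¬Z ⊆ Y →
      ∃ p : MvPolynomial σ k, p ∈ vanishingIdeal k Y ∧ p ∉ vanishingIdeal k Z := by
    intro Y hY hZY
    by_contra hall
    push Not at hall
    apply hZY
    intro x hx
    rw [← zeroLocus_vanishingIdeal_of_isClosed hY, mem_zeroLocus_iff]
    intro p hp
    exact (mem_vanishingIdeal_iff.1 (hall p hp)) x hx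
  obtain ⟨p, hp1, hpZ⟩ := key hZ₁ h1
  obtain ⟨q, hq2, hqZ⟩ := key hZ₂ h2
  have hpq : p * q ∈ vanishingIdeal k Z := mem_vanishingIdeal_iff.2 fun x hx => by
    rw [map_mul]
    rcases hsub hx with hx' | hx'
    · rw [(mem_vanishingIdeal_iff.1 hp1) x hx', zero_mul]
    · rw [(mem_vanishingIdeal_iff.1 hq2) x hx', mul_zero]
  rcases hp.mem_or_mem hpq with h | h
  · exact hpZ h
  · exact hqZ h

/-- A maximal irreducible subset of a closed set is closed. [folklore] -/
theorem isClosed_of_maximal_isIrreducible {F Z : Set (σ → k)} (hF : IsClosed F)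
    (hZ : Maximal (fun T : Set (σ → k) => IsIrreducible T ∧ T ⊆ F) Z) : IsClosed Z := by
  have h : closure Z ⊆ Z :=
    hZ.2 ⟨hZ.1.1.closure, closure_minimal hZ.1.2 hF⟩ subset_closure
  exact closure_subset_iff_isClosed.1 h

end Ideals

/-! ### Generic fibres of a polynomial map (Springer 5.1.6 (ii)) -/

section Fibre

variable [Finite σ] [Finite τ]

/-- **Dimension of the generic fibres of a polynomial map** (Springer, *Linear Algebraic Groups*,
Thm. 5.1.6 (ii), for `k`-points over an algebraically closed field): let `V ⊆ kⁿ` be closed and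
irreducible, `φ : kⁿ → kᵐ` a polynomial map and `W` the closure of `φ(V)`. Writing
`dim Z = dim k[x] ⧸ I(Z)`, there are a natural number `r` with `dim V = dim W + r` and a Zariski
open `U ⊆ kᵐ` meeting `φ(V)` such that for every `y ∈ U` **every irreducible component of the
fibre `V ∩ φ⁻¹ y` has dimension `r`**. (Over the open set the fibres are also non-empty on `W`,
by Chevalley's theorem `exists_isOpen_inter_closure_image_subset`, Springer 1.9.5.)
[cite: SpringerLAG1998, 5.1.6 (ii)] -/
theorem exists_isOpen_ringKrullDim_fibre_eq [IsAlgClosed k] {V : Set (σ → k)} (hV : IsClosed V)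
    (hVirr : IsIrreducible V) {φ : (σ → k) → (τ → k)} (P : τ → MvPolynomial σ k)
    (hφ : ∀ x t, φ x t = MvPolynomial.eval x (P t)) :
    ∃ (U : Set (τ → k)) (e r : ℕ), IsOpen U ∧ (U ∩ φ '' V).Nonempty ∧
      ringKrullDim (MvPolynomial τ k ⧸ vanishingIdeal k (closure (φ '' V))) = e ∧
      ringKrullDim (MvPolynomial σ k ⧸ vanishingIdeal k V) = (e + r : ℕ) ∧
      ∀ y ∈ U, ∀ Z : Set (σ → k),
        Maximal (fun T : Set (σ → k) => IsIrreducible T ∧ T ⊆ V ∩ φ ⁻¹' {y}) Z →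
          ringKrullDim (MvPolynomial σ k ⧸ vanishingIdeal k Z) = r := by
  classical
  have hφ_cont : Continuous φ := continuous_of_polynomialMap P hφ
  have hφ' : ∀ x, φ x = fun t => MvPolynomial.eval x (P t) := fun x => funext (hφ x)
  -- notation: `W = closure φ(V)`, `IV = I(V)`, `IW = I(W)`, comorphism `ψ = φ^*`
  set W : Set (τ → k) := closure (φ '' V) with hWdef
  have hWirr : IsIrreducible W := (hVirr.image φ hφ_cont.continuousOn).closure
  set IV : Ideal (MvPolynomial σ k) := vanishingIdeal k V with hIVdef
  set IW : Ideal (MvPolynomial τ k) := vanishingIdeal k W with hIWdef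
  haveI hIVp : IV.IsPrime := isPrime_vanishingIdeal_of_isIrreducible_pi hVirr
  haveI hIWp : IW.IsPrime := isPrime_vanishingIdeal_of_isIrreducible_pi hWirr
  set ψ : MvPolynomial τ k →ₐ[k] MvPolynomial σ k := MvPolynomial.bind₁ P with hψdef
  have hψeval : ∀ (x : σ → k) (p : MvPolynomial τ k), aeval x (ψ p) = aeval (φ x) p := by
    intro x p
    change MvPolynomial.eval x (MvPolynomial.bind₁ P p) = MvPolynomial.eval (φ x) p
    rw [hφ' x]
    exact eval_bind₁' x P p
  -- `ψ⁻¹ I(V) = I(W)`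
  have hcomap : IV.comap ψ = IW := by
    ext p
    rw [Ideal.mem_comap, hIVdef, mem_vanishingIdeal_iff, hIWdef, mem_vanishingIdeal_iff]
    constructor
    · intro h
      have hcl : IsClosed {y : τ → k | aeval y p = 0} := isClosed_setOf_eval_eq_zero p
      have hsub : φ '' V ⊆ {y : τ → k | aeval y p = 0} := by
        rintro _ ⟨x, hx, rfl⟩
        rw [Set.mem_setOf_eq, ← hψeval]
        exact h x hx
      exact fun y hy => closure_minimal hsub hcl hy
    · intro h x hx
      rw [hψeval]
      exact h (φ x) (subset_closure ⟨x, hx, rfl⟩)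
  have hle : IW ≤ IV.comap ψ := le_of_eq hcomap.symm
  -- the coordinate rings `A = k[W] ↪ B = k[V]`
  set Aq := MvPolynomial τ k ⧸ IW
  set Bq := MvPolynomial σ k ⧸ IV
  letI algAB : Algebra Aq Bq := (Ideal.quotientMap IV ψ.toRingHom hle).toAlgebra
  have halg : ∀ p : MvPolynomial τ k, algebraMap Aq Bq (Ideal.Quotient.mk IW p) =
      Ideal.Quotient.mk IV (ψ p) := fun p => Ideal.quotientMap_mk
  haveI : IsScalarTower k Aq Bq := by
    refine IsScalarTower.of_algebraMap_eq (R := k) (S := Aq) (A := Bq) fun c => ?_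
    change Ideal.Quotient.mk IV (algebraMap k _ c) =
      Ideal.quotientMap IV ψ.toRingHom hle (Ideal.Quotient.mk IW (algebraMap k _ c))
    rw [Ideal.quotientMap_mk]
    congr 1
    exact (ψ.commutes c).symm
  haveI : FaithfulSMul Aq Bq := (faithfulSMul_iff_algebraMap_injective Aq Bq).2
    (Ideal.quotientMap_injective' (le_of_eq hcomap))
  haveI : IsDomain Aq := Ideal.Quotient.isDomain IW
  haveI : IsDomain Bq := Ideal.Quotient.isDomain IV
  obtain ⟨f, e, r, hf0, hdimA, hdimB, hfib⟩ :=
    Literature.RingTheory.KrullDimension.exists_ringKrullDim_quotient_eq_of_mem_minimalPrimes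
      (A := Aq) (B := Bq) k
  obtain ⟨f, rfl⟩ := Ideal.Quotient.mk_surjective f
  have hfW : f ∉ IW := fun h => hf0 (Ideal.Quotient.eq_zero_iff_mem.2 h)
  -- the open set `U = D(f)`
  have hUopen : IsOpen {y : τ → k | aeval y f ≠ 0} := by
    have hcl : IsClosed {y : τ → k | aeval y f = 0} := isClosed_setOf_eval_eq_zero f
    simpa only [Set.compl_setOf, not_not] using hcl.isOpen_compl
  refine ⟨{y | aeval y f ≠ 0}, e, r, hUopen, ?_, hdimA, hdimB, fun y hy Z hZ => ?_⟩
  · -- `D(f)` meets `W = closure φ(V)`, hence meets `φ(V)`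
    have hW' : ¬ W ⊆ {y | aeval y f = 0} := fun h =>
      hfW (mem_vanishingIdeal_iff.2 fun y hy => h hy)
    obtain ⟨y, hyW, hyf⟩ := Set.not_subset.1 hW'
    have hne : (closure (φ '' V) ∩ {y : τ → k | aeval y f ≠ 0}).Nonempty := ⟨y, hyW, hyf⟩
    rw [closure_inter_open_nonempty_iff hUopen] at hne
    rwa [Set.inter_comm]
  · have hZirr : IsIrreducible Z := hZ.1.1
    have hZF : Z ⊆ V ∩ φ ⁻¹' {y} := hZ.1.2
    have hZcl : IsClosed Z :=
      isClosed_of_maximal_isIrreducible (hV.inter ((isClosed_singleton_pi y).preimage hφ_cont)) hZ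
    obtain ⟨z, hz⟩ := hZirr.nonempty
    have hzy : φ z = y := (hZF hz).2
    have hyW : y ∈ W := subset_closure ⟨z, (hZF hz).1, hzy⟩
    -- the maximal ideal `m = 𝔪_y ⊇ I(W)` and its image `mA` in `A`
    set m : Ideal (MvPolynomial τ k) := vanishingIdeal k ({y} : Set (τ → k)) with hmdef
    have hmmax : m.IsMaximal := inferInstance
    have hIWm : IW ≤ m := vanishingIdeal_anti_mono (Set.singleton_subset_iff.2 hyW)
    set mA : Ideal Aq := m.map (Ideal.Quotient.mk IW) with hmAdef
    have hmAc : mA.comap (Ideal.Quotient.mk IW) = m := by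
      rw [hmAdef, Ideal.comap_map_of_surjective _ Ideal.Quotient.mk_surjective,
        ← RingHom.ker_eq_comap_bot, Ideal.mk_ker, sup_eq_left.2 hIWm]
    have hmAmax : mA.IsMaximal := by
      rcases Ideal.map_eq_top_or_isMaximal_of_surjective (Ideal.Quotient.mk IW)
        Ideal.Quotient.mk_surjective hmmax
        with h | h
      · exfalso
        apply hmmax.ne_top
        rw [← hmAc]
        change (Ideal.map (Ideal.Quotient.mk IW) m).comap _ = ⊤
        rw [h, Ideal.comap_top]
      · exact h
    have hfmA : Ideal.Quotient.mk IW f ∉ mA := fun h => hy (by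
      have h' : f ∈ mA.comap (Ideal.Quotient.mk IW) := h
      rw [hmAc, hmdef, mem_vanishingIdeal_singleton_iff] at h'
      exact h')
    -- the prime `PZ = I(Z)/I(V)` of `B` is minimal over `mA B`
    have hIVZ : IV ≤ vanishingIdeal k Z := vanishingIdeal_anti_mono fun x hx => (hZF hx).1
    have hIZp : (vanishingIdeal k Z).IsPrime := isPrime_vanishingIdeal_of_isIrreducible_pi hZirr
    set PZ : Ideal Bq := (vanishingIdeal k Z).map (Ideal.Quotient.mk IV) with hPZdef
    have hPZc : PZ.comap (Ideal.Quotient.mk IV) = vanishingIdeal k Z := by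
      rw [hPZdef, Ideal.comap_map_of_surjective _ Ideal.Quotient.mk_surjective,
        ← RingHom.ker_eq_comap_bot, Ideal.mk_ker, sup_eq_left.2 hIVZ]
    have hPZp : PZ.IsPrime :=
      Ideal.map_isPrime_of_surjective Ideal.Quotient.mk_surjective (by rwa [Ideal.mk_ker])
    have hmψ : ∀ p ∈ m, ψ p ∈ vanishingIdeal k Z := fun p hp =>
      mem_vanishingIdeal_iff.2 fun x hx => by
        rw [hψeval, show φ x = y from (hZF hx).2]
        exact (mem_vanishingIdeal_singleton_iff y p).1 hp
    have hcompAB : (algebraMap Aq Bq).comp (Ideal.Quotient.mk IW) =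
        (Ideal.Quotient.mk IV).comp ψ.toRingHom := RingHom.ext fun p => halg p
    have hmAB : mA.map (algebraMap Aq Bq) = (m.map ψ.toRingHom).map (Ideal.Quotient.mk IV) := by
      rw [hmAdef, Ideal.map_map, hcompAB, ← Ideal.map_map]
    have hPZmin : PZ ∈ (mA.map (algebraMap Aq Bq)).minimalPrimes := by
      rw [hmAB]
      refine ⟨⟨hPZp, ?_⟩, fun Q ⟨hQp, hQle⟩ hQPZ => ?_⟩
      · rw [hPZdef]
        exact Ideal.map_mono (Ideal.map_le_iff_le_comap.2 fun p hp => hmψ p hp)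
      · -- minimality via the zero locus `T` of `q = Q ∩ k[x]`
        set q : Ideal (MvPolynomial σ k) := Q.comap (Ideal.Quotient.mk IV) with hqdef
        have hqp : q.IsPrime := Ideal.IsPrime.comap _
        have hIVq : IV ≤ q := fun p hp => by
          rw [hqdef, Ideal.mem_comap, Ideal.Quotient.eq_zero_iff_mem.2 hp]
          exact Q.zero_mem
        have hmq : ∀ p ∈ m, ψ p ∈ q := fun p hp => by
          rw [hqdef, Ideal.mem_comap]
          exact hQle (Ideal.mem_map_of_mem _ (Ideal.mem_map_of_mem _ hp))
        have hqZ : q ≤ vanishingIdeal k Z := by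
          rw [hqdef, ← hPZc]
          exact Ideal.comap_mono hQPZ
        set T : Set (σ → k) := zeroLocus k q with hTdef
        have hIT : vanishingIdeal k T = q := by
          rw [hTdef, vanishingIdeal_zeroLocus_eq_radical, hqp.radical]
        have hZT : Z ⊆ T := by
          rw [hTdef, ← zeroLocus_vanishingIdeal_of_isClosed hZcl]
          exact zeroLocus_anti_mono hqZ
        have hTirr : IsIrreducible T :=
          isIrreducible_of_isPrime_vanishingIdeal ⟨z, hZT hz⟩ (by rw [hIT]; exact hqp)
        have hTF : T ⊆ V ∩ φ ⁻¹' {y} := fun x hx => by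
          have hx' := mem_zeroLocus_iff.1 hx
          refine ⟨?_, ?_⟩
          · rw [← zeroLocus_vanishingIdeal_of_isClosed hV]
            exact mem_zeroLocus_iff.2 fun p hp => hx' p (hIVq hp)
          · rw [Set.mem_preimage, ← zeroLocus_vanishingIdeal_singleton y, mem_zeroLocus_iff]
            intro p hp
            rw [← hψeval]
            exact hx' _ (hmq p hp)
        have hTZ : T ⊆ Z := hZ.2 ⟨hTirr, hTF⟩ hZT
        have hZq : vanishingIdeal k Z ≤ q := hIT ▸ vanishingIdeal_anti_mono hTZ
        calc PZ = (vanishingIdeal k Z).map (Ideal.Quotient.mk IV) := rfl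
          _ ≤ q.map (Ideal.Quotient.mk IV) := Ideal.map_mono hZq
          _ = Q := Ideal.map_comap_of_surjective _ Ideal.Quotient.mk_surjective Q
    -- conclude with the algebraic theorem and `B/PZ ≃ k[x]/I(Z)`
    rw [← hfib mA hmAmax hfmA PZ hPZmin]
    exact (ringKrullDim_eq_of_ringEquiv (DoubleQuot.quotQuotEquivQuotOfLE hIVZ)).symm

end Fibre


/-! ### Subsets of `GL n k`: translation invariance of the dimension and dimension of orbits -/

section GLOrbits

variable {n : Type*} [Fintype n] [DecidableEq n]

attribute [local instance] zariskiTopologyGL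

open scoped MatrixGroups Pointwise

/-- `(p ∘ L_h)(g) = p (h g)`: evaluating the substituted polynomial `p (leftMulPolyGL h)` at the
coordinates of `g` (as in `LieAlgebraGLDimension.lean`, not imported here). [folklore] -/
lemma eval_glCoordFun_aeval_leftMulPolyGL (h g : GL n k) (p : MvPolynomial (GLCoord n) k) :
    MvPolynomial.eval (glCoordFun g) (MvPolynomial.aeval (leftMulPolyGL h) p) =
      MvPolynomial.eval (glCoordFun (h * g)) p := by
  rw [MvPolynomial.aeval_eq_bind₁, eval_bind₁]
  have hf : (fun i => MvPolynomial.eval (glCoordFun g) (leftMulPolyGL h i)) = glCoordFun (h * g) :=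
    funext fun c => eval_leftMulPolyGL h g c
  rw [hf]

/-- **Left translation does not change the dimension** `dim k[x, y] ⧸ I(X)` of a subset
`X ⊆ GL n k`: the substitution `p ↦ p ∘ L_h` induces a ring isomorphism
`k[x, y] ⧸ I(h X) ≃ k[x, y] ⧸ I(X)` (Springer 2.1.2: translations are automorphisms of the variety
`GL n`). [folklore] -/
theorem ringKrullDim_quotient_vanishingIdeal_smul_eq (h : GL n k) (X : Set (GL n k)) :
    ringKrullDim (MvPolynomial (GLCoord n) k ⧸ vanishingIdeal k (glCoordFun '' (h • X))) =
      ringKrullDim (MvPolynomial (GLCoord n) k ⧸ vanishingIdeal k (glCoordFun '' X)) := by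
  set IX : Ideal (MvPolynomial (GLCoord n) k) := vanishingIdeal k (glCoordFun '' X) with hIXdef
  set IhX : Ideal (MvPolynomial (GLCoord n) k) := vanishingIdeal k (glCoordFun '' (h • X))
    with hIhXdef
  set α : MvPolynomial (GLCoord n) k →ₐ[k] MvPolynomial (GLCoord n) k :=
    MvPolynomial.aeval (leftMulPolyGL h) with hαdef
  set β : MvPolynomial (GLCoord n) k →ₐ[k] MvPolynomial (GLCoord n) k :=
    MvPolynomial.aeval (leftMulPolyGL h⁻¹) with hβdef
  have hα : IhX ≤ IX.comap α.toRingHom := fun p hp => by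
    rw [Ideal.mem_comap, hIXdef, mem_vanishingIdeal_glCoordFun_iff]
    intro g hg
    change MvPolynomial.eval (glCoordFun g) (MvPolynomial.aeval (leftMulPolyGL h) p) = 0
    rw [eval_glCoordFun_aeval_leftMulPolyGL]
    exact (mem_vanishingIdeal_glCoordFun_iff.1 hp) (h * g) (Set.smul_mem_smul_set hg)
  have hβ : IX ≤ IhX.comap β.toRingHom := fun p hp => by
    rw [Ideal.mem_comap, hIhXdef, mem_vanishingIdeal_glCoordFun_iff]
    rintro _ ⟨g, hg, rfl⟩
    change MvPolynomial.eval (glCoordFun (h * g)) (MvPolynomial.aeval (leftMulPolyGL h⁻¹) p) = 0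
    rw [eval_glCoordFun_aeval_leftMulPolyGL, inv_mul_cancel_left]
    exact (mem_vanishingIdeal_glCoordFun_iff.1 hp) g hg
  set a : MvPolynomial (GLCoord n) k ⧸ IhX →+* MvPolynomial (GLCoord n) k ⧸ IX :=
    Ideal.quotientMap IX α.toRingHom hα with hadef
  set b : MvPolynomial (GLCoord n) k ⧸ IX →+* MvPolynomial (GLCoord n) k ⧸ IhX :=
    Ideal.quotientMap IhX β.toRingHom hβ with hbdef
  have h1 : ∀ z, a (b z) = z := by
    intro z
    obtain ⟨p, rfl⟩ := Ideal.Quotient.mk_surjective z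
    rw [hbdef, Ideal.quotientMap_mk, hadef, Ideal.quotientMap_mk, Ideal.Quotient.eq, hIXdef,
      mem_vanishingIdeal_glCoordFun_iff]
    intro g hg
    change MvPolynomial.eval (glCoordFun g) (MvPolynomial.aeval (leftMulPolyGL h)
      (MvPolynomial.aeval (leftMulPolyGL h⁻¹) p) - p) = 0
    rw [map_sub, eval_glCoordFun_aeval_leftMulPolyGL, eval_glCoordFun_aeval_leftMulPolyGL,
      inv_mul_cancel_left, sub_self]
  have h2 : ∀ z, b (a z) = z := by
    intro z
    obtain ⟨p, rfl⟩ := Ideal.Quotient.mk_surjective z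
    rw [hadef, Ideal.quotientMap_mk, hbdef, Ideal.quotientMap_mk, Ideal.Quotient.eq, hIhXdef,
      mem_vanishingIdeal_glCoordFun_iff]
    rintro _ ⟨g, hg, rfl⟩
    change MvPolynomial.eval (glCoordFun (h * g)) (MvPolynomial.aeval (leftMulPolyGL h⁻¹)
      (MvPolynomial.aeval (leftMulPolyGL h) p) - p) = 0
    rw [map_sub, eval_glCoordFun_aeval_leftMulPolyGL, eval_glCoordFun_aeval_leftMulPolyGL,
      mul_inv_cancel_left, sub_self]
  refine ringKrullDim_eq_of_ringEquiv (RingEquiv.ofBijective a ⟨fun x y hxy => ?_, fun z => ⟨b z, h1 z⟩⟩)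
  have h' := congrArg b hxy
  rwa [h2, h2] at h'

variable [Finite τ]

/-- **Dimension of orbits** (Springer, *Linear Algebraic Groups*, 5.3.2 (ii) with 2.3.3, in the
form "`dim G = dim G_v + dim (G · v)⁻`"; derived here from the generic fibre theorem 5.1.6 (ii)):
let `G ≤ GL n k` be a Zariski-connected algebraic subgroup over an algebraically closed field,
`Φ : GL n k → kᵐ` a map polynomial in the coordinates `x i j, det⁻¹` (an orbit map `g ↦ g · v`),
and `S ≤ G` an algebraic subgroup which is the stabiliser: `Φ g' = Φ g ↔ g⁻¹ g' ∈ S` for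
`g, g' ∈ G`. Then `dim G = dim S° + dim (Φ G)⁻`, where `dim G = hG.zdim`, `S°` is the identity
component of `S` (so `dim S° = dim S`) and `dim (Φ G)⁻ = dim k[y] ⧸ I((Φ G)⁻)`.
[cite: SpringerLAG1998, 5.3.2 (ii)] -/
theorem exists_zdim_eq_zdim_identityComponent_add [IsAlgClosed k] {G S : Subgroup (GL n k)}
    (hG : IsZConnected G) (hS : IsAlgebraicSubgroup S) (hSG : S ≤ G)
    {Φ : GL n k → (τ → k)} (P : τ → MvPolynomial (GLCoord n) k)
    (hΦ : ∀ g t, Φ g t = MvPolynomial.eval (glCoordFun g) (P t))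
    (hstab : ∀ g ∈ G, ∀ g' ∈ G, Φ g' = Φ g ↔ g⁻¹ * g' ∈ S) :
    ∃ e r : ℕ, ringKrullDim (MvPolynomial τ k ⧸ vanishingIdeal k (closure (Φ '' G))) = e ∧
      hG.zdim = e + r ∧ (isZConnected_identityComponent hS).zdim = r := by
  classical
  set V : Set (GLCoord n → k) := glCoordFun '' (G : Set (GL n k)) with hVdef
  have hVcl : IsClosed V := isClosedEmbedding_glCoordFun.isClosedMap _ hG.1.isClosed
  have hVirr : IsIrreducible V := isIrreducible_image_glCoordFun hG.isIrreducible
  set φ : (GLCoord n → k) → (τ → k) := fun x t => MvPolynomial.eval x (P t) with hφdef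
  have hφΦ : ∀ g, φ (glCoordFun g) = Φ g := fun g => funext fun t => (hΦ g t).symm
  have himage : φ '' V = Φ '' G := by
    rw [hVdef, Set.image_image]
    exact Set.image_congr fun g _ => hφΦ g
  obtain ⟨U, e, r, hU, hne, hdimW, hdimV, hfib⟩ :=
    exists_isOpen_ringKrullDim_fibre_eq hVcl hVirr P (fun x t => rfl)
  rw [himage] at hne hdimW
  refine ⟨e, r, hdimW, ?_, ?_⟩
  · have h := hG.coe_zdim_eq_ringKrullDim_quotient
    rw [← hVdef, hdimV] at h
    exact_mod_cast h
  · -- a point `Φ g₀` of the orbit in `U`; the fibre over it is `g₀ S` in coordinates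
    obtain ⟨_, hyU, g₀, hg₀, rfl⟩ := hne
    set S₀ : Subgroup (GL n k) := identityComponent S with hS₀def
    have hS₀ : IsZConnected S₀ := isZConnected_identityComponent hS
    have hS₀S : S₀ ≤ S := identityComponent_le S
    set Z : Set (GLCoord n → k) := glCoordFun '' (g₀ • (S₀ : Set (GL n k))) with hZdef
    -- the finitely many closed pieces `g₀ s S°` of the fibre
    set Q := ↥S ⧸ (S₀.subgroupOf S) with hQdef
    haveI : (S₀.subgroupOf S).FiniteIndex := finiteIndex_identityComponent hS
    haveI : Finite Q := Subgroup.finite_quotient_of_finiteIndex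
    haveI : Fintype Q := Fintype.ofFinite Q
    set C : Q → Set (GLCoord n → k) := fun q =>
      glCoordFun '' ((g₀ * ((Quotient.out q : ↥S) : GL n k)) • (S₀ : Set (GL n k))) with hCdef
    have hCcl : ∀ q, IsClosed (C q) := fun q =>
      isClosedEmbedding_glCoordFun.isClosedMap _ (by
        rw [← image_zariskiMulLeft]
        exact (zariskiMulLeft _).isClosedMap _ hS₀.1.isClosed)
    have hfibre : V ∩ φ ⁻¹' {Φ g₀} ⊆ ⋃ q, C q := by
      rintro _ ⟨⟨g, hg, rfl⟩, hgy⟩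
      rw [Set.mem_preimage, hφΦ, Set.mem_singleton_iff] at hgy
      have hs : g₀⁻¹ * g ∈ S := (hstab g₀ hg₀ g hg).1 hgy
      obtain ⟨h', H⟩ := QuotientGroup.mk_out_eq_mul (S₀.subgroupOf S) (⟨g₀⁻¹ * g, hs⟩ : ↥S)
      refine Set.mem_iUnion.2 ⟨QuotientGroup.mk (⟨g₀⁻¹ * g, hs⟩ : ↥S), ?_⟩
      simp only [hCdef]
      refine ⟨g₀ * ((Quotient.out (QuotientGroup.mk (s := S₀.subgroupOf S)
        (⟨g₀⁻¹ * g, hs⟩ : ↥S)) : ↥S) : GL n k) * ((h' : ↥S) : GL n k)⁻¹, ?_, ?_⟩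
      · refine Set.mem_smul_set.2 ⟨((h' : ↥S) : GL n k)⁻¹, ?_, rfl⟩
        exact S₀.inv_mem ((Subgroup.mem_subgroupOf).1 h'.2)
      · have H' := congrArg (fun s : ↥S => (s : GL n k)) H
        simp only [Subgroup.coe_mul] at H'
        change glCoordFun (g₀ * _ * _) = glCoordFun g
        rw [H', mul_assoc, mul_assoc, mul_inv_cancel, mul_one, mul_inv_cancel_left]
    -- `Z` is an irreducible component of the fibre
    have hZmax : Maximal (fun T : Set (GLCoord n → k) => IsIrreducible T ∧ T ⊆ V ∩ φ ⁻¹' {Φ g₀}) Z := by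
      refine ⟨⟨?_, ?_⟩, fun T ⟨hTirr, hTF⟩ hZT => ?_⟩
      · rw [hZdef, ← image_zariskiMulLeft]
        exact isIrreducible_image_glCoordFun
          (hS₀.isIrreducible.image _ (zariskiMulLeft g₀).continuous.continuousOn)
      · rintro _ ⟨_, ⟨s, hs, rfl⟩, rfl⟩
        have hsG : g₀ * s ∈ G := G.mul_mem hg₀ (hSG (hS₀S hs))
        refine ⟨⟨g₀ * s, hsG, rfl⟩, ?_⟩
        rw [Set.mem_preimage, hφΦ, Set.mem_singleton_iff]
        exact (hstab g₀ hg₀ (g₀ * s) hsG).2 (by rw [inv_mul_cancel_left]; exact hS₀S hs)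
      · -- `T` lies in one of the closed pieces, which must be `Z`
        obtain ⟨z, hz, hTz⟩ := (isIrreducible_iff_sUnion_isClosed.1 hTirr)
          (Finset.univ.image C) (by simp only [Finset.mem_image, Finset.mem_univ, true_and,
            forall_exists_index, forall_apply_eq_imp_iff]; exact hCcl)
          (fun x hx => by
            obtain ⟨q, hq⟩ := Set.mem_iUnion.1 (hfibre (hTF hx))
            exact Set.mem_sUnion.2 ⟨C q, by simp, hq⟩)
        obtain ⟨q, -, rfl⟩ := Finset.mem_image.1 hz
        -- `g₀ ∈ g₀ S° ⊆ T ⊆ C q`, so the coset `g₀ q.out S°` is `g₀ S°`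
        have hg₀Z : glCoordFun g₀ ∈ Z := ⟨g₀, Set.mem_smul_set.2 ⟨1, S₀.one_mem, mul_one g₀⟩, rfl⟩
        obtain ⟨_, ⟨s, hs, rfl⟩, hgs⟩ := hTz (hZT hg₀Z)
        have hgs' := glCoordFun_injective hgs
        -- `g₀ * q.out * s = g₀`, hence `q.out = s⁻¹ ∈ S°`
        have hout : ((Quotient.out q : ↥S) : GL n k) ∈ S₀ := by
          have h1 : ((Quotient.out q : ↥S) : GL n k) = s⁻¹ := by
            have h2 : g₀ * ((Quotient.out q : ↥S) : GL n k) * s = g₀ := hgs'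
            rw [mul_assoc] at h2
            have h3 : ((Quotient.out q : ↥S) : GL n k) * s = 1 := mul_left_cancel (by rw [h2, mul_one])
            exact eq_inv_of_mul_eq_one_left h3
          rw [h1]
          exact S₀.inv_mem hs
        have hCq : C q = Z := by
          simp only [hCdef, hZdef]
          rw [mul_smul, smul_coe_set hout]
        rw [← hCq]
        exact hTz
    have hdimZ := hfib (Φ g₀) hyU Z hZmax
    rw [hZdef, ringKrullDim_quotient_vanishingIdeal_smul_eq, ← hS₀.coe_zdim_eq_ringKrullDim_quotient]
      at hdimZ
    exact_mod_cast hdimZ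

end GLOrbits

end Literature.NumberTheory.Automorphic
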